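import Literature.Analysis.FluidPDE.ElgindiHkDensity
import HarnessLib

/-!
# The `𝓗⁴`-closure class of the test functions of the open strip, characterized
([Elgindi2021] §8.1 Remark 8.3; the faithful data class of the stability theorem)

Topic `Literature/Analysis/FluidPDE`. Support file (definitions with bodies and proved theorems, no
named facts) on the proof path of the named fact
`Literature.Analysis.FluidPDE.Elgindi.ElgindiGhoulMasmoudi2021_stabilityCore`
(`ElgindiStabilityDecomposition.lean`). T. M. Elgindi, Ann. of Math. 194 (2021) =
arXiv:1904.04795, §8.1 Remark 8.3 (p. 27); [ElgindiGhoulMasmoudi2021] §1.7 (p. 6).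

A function `F` smooth on the open strip is the `𝓗⁴`-limit of test functions of the open strip
(`∃ f, HkApprox α F f`) **iff** `|F|_{𝓗⁴} < ∞` and its `γ`-weighted radial words are finite
(`gammaWords α F < ∞`): the forward direction by Fatou from the `γ`-Hardy inequality for test
functions (`lintegral_radialWord_le_closure`), the converse by the logarithmic/angular cut-offs
(`hkApprox_cutFun`). Together with `ElgindiHkNonDensity.lean` (θ-constant data have
`|F|_{𝓗⁴} < ∞` but `gammaWords = ∞`-type obstruction) this identifies the data class on which the
printed proofs operate.
-/

noncomputable section

open MeasureTheory Set Function Real Filter Finset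
open _root_.Topology
open scoped ENNReal ContDiff

namespace Literature.Analysis.FluidPDE

namespace Elgindi

/-- **Closure data have finite `γ`-words**: `gammaWords α F ≤ 8(π/(γ−1))²|F|²_{𝓗⁴} < ∞`. [cite: Elgindi2021, §8.1 Lemma 8.1 and Remark 8.3 (pp. 25, 27 of arXiv:1904.04795)] -/
theorem HkApprox.gammaWords_le {α : ℝ} (hα : 0 < α) (hα10 : α ≤ 10) {F : ℝ → ℝ → ℝ} {fs : ℕ → ℝ → ℝ → ℝ} (hA : HkApprox α F fs) :
    gammaWords α F ≤ 4 * (2 * ENNReal.ofReal ((π / (gammaExp α - 1)) ^ 2) * eHkNormSq α 4 F) := by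
  unfold gammaWords
  calc ∑ j ∈ range 4, ∫⁻ p in strip, ENNReal.ofReal (radialWeight p.1 ^ 2 * ((Dz^[j] F) p.1 p.2) ^ 2 * Real.sin (2 * p.2) ^ (-gammaExp α))
      ≤ ∑ _j ∈ range 4, 2 * ENNReal.ofReal ((π / (gammaExp α - 1)) ^ 2) * eHkNormSq α 4 F :=
        sum_le_sum fun j hj => lintegral_radialWord_le_closure hα hα10 hA (by have := mem_range.1 hj; omega)
    _ = 4 * (2 * ENNReal.ofReal ((π / (gammaExp α - 1)) ^ 2) * eHkNormSq α 4 F) := by rw [sum_const, card_range]; simp [nsmul_eq_mul]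

/-- Closure data have `gammaWords < ∞`. [folklore] -/
theorem HkApprox.gammaWords_lt_top {α : ℝ} (hα : 0 < α) (hα10 : α ≤ 10) {F : ℝ → ℝ → ℝ} {fs : ℕ → ℝ → ℝ → ℝ} (hA : HkApprox α F fs) :
    gammaWords α F < ⊤ :=
  lt_of_le_of_lt (hA.gammaWords_le hα hα10) (ENNReal.mul_lt_top (by norm_num)
    (ENNReal.mul_lt_top (ENNReal.mul_lt_top (by norm_num) ENNReal.ofReal_lt_top) hA.eHkNormSq_lt_top))

/-- **Characterization of the closure class**: for `0 < α ≤ 10`, a function is the `𝓗⁴`-limit of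
test functions of the open strip iff it is smooth on the strip with `|F|_{𝓗⁴} < ∞` and
`gammaWords α F < ∞`. [cite: Elgindi2021, §8.1 Remark 8.3 (p. 27 of arXiv:1904.04795)] -/
theorem exists_hkApprox_iff {α : ℝ} (hα : 0 < α) (hα10 : α ≤ 10) {F : ℝ → ℝ → ℝ} :
    (∃ fs : ℕ → ℝ → ℝ → ℝ, HkApprox α F fs) ↔ ContDiffOn ℝ ∞ (uncurry F) strip ∧ eHkNormSq α 4 F < ⊤ ∧ gammaWords α F < ⊤ := by
  constructor
  · rintro ⟨fs, hA⟩
    exact ⟨hA.smooth, hA.eHkNormSq_lt_top, hA.gammaWords_lt_top hα hα10⟩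
  · rintro ⟨hs, hE, hH⟩
    exact ⟨_, hkApprox_cutFun α hs hE hH⟩

end Elgindi

end Literature.Analysis.FluidPDE
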